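import Mathlib.Analysis.SpecialFunctions.Trigonometric.Deriv
import Mathlib.Topology.Instances.Matrix
import Literature.Probability.LatticeModels.DiagonalTransferVacuum
import Literature.Probability.LatticeModels.IsingRowDeterminant
import HarnessLib

/-!
# The in-layer pair correlation of the critical diagonal cylinder state: a Cauchy-type determinant

Topic `Probability/LatticeModels`, namespace `Literature.Probability.LatticeModels`. Fourth file of
the exact computation of the critical diagonal correlations of the planar Ising model behind
`Literature.Probability.LatticeModels.wu_rhoCHI`. With the Perron vector `ψ` of the critical
two-layer diagonal transfer matrix `T₂` identified as a polarized (Fock) vacuum of the Ising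
Majorana family for the polarization `tfiPol N` of the critical transverse-field Ising chain
(`DiagonalTransferVacuum.exists_diagPerron_polarizedVacuum`), Wick's theorem in determinant form
(`QuasiFreeVacuum.expect_prodPairs_div`) and the telescoping `σᶻ_0σᶻ_n = i^n B_0A_1B_1A_2⋯B_{n-1}A_n`
(`IsingRowDeterminant`) give, exactly as for the row transfer matrix (T. D. Schultz, D. C. Mattis,
E. H. Lieb, Rev. Mod. Phys. 36 (1964) 856, §V), the ground-state pair correlation as an `n × n`
determinant of contractions; for the critical chain these contractions are explicit (P. Pfeuty, Ann.
Phys. 57 (1970) 79, §3: the correlation `⟨σˣ_0σˣ_n⟩` of the transverse Ising chain as a Toeplitz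
determinant of `G_r`, in closed form at `λ = 1`):

* `diagCylKernel N i j = ⟨B_iA_j⟩ = -N⁻¹ ∑_m e^{iq_m(j-i)} e^{-iq_m/2}` over the antiperiodic momenta,
  in CLOSED FORM `= -i / (N sin(π(2(j-i)-1)/(2N)))` (`diagCylKernel_eq`, a geometric sum);
* `diagPerron_pair_eq_det` — for the Perron vector `ψ > 0` of `T₂` at `β_c(2)` and `n < N`:
  `∑_r r_0 r_n ψ(r)² / ∑_r ψ(r)² = i^n det (⟨B_iA_{j+1}⟩)_{i,j<n} = det (1/(N sin(π(2(j-i)+1)/(2N))))_{i,j<n}`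
  (`diagPerron_pair_eq_real_det`);
* `tendsto_det_diagCyl` — as `N → ∞` this determinant tends to **`det (2/(π(2(j-i)+1)))_{i,j<n}`**
  (entrywise `N sin(x/N) → x` and continuity of `det`), the Cauchy determinant evaluated as Wu's
  product `wuDiag n` in `PlanarIsingWuCauchy`.

Everything is proved; no named fact. The identification of the left-hand side with the torus /
infinite-volume diagonal correlation `⟨σ_{(0,0)}σ_{(n,n)}⟩_{β_c}` is the business of the torus files.

## References

* T. D. Schultz, D. C. Mattis, E. H. Lieb, Rev. Mod. Phys. 36 (1964) 856–871, §V.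
* P. Pfeuty, Ann. Phys. 57 (1970) 79–90, §3.
* B. M. McCoy, T. T. Wu, *The two-dimensional Ising model* (1973), Ch. XI.
-/

noncomputable section

open Matrix Complex Finset Filter Topology Literature.MathematicalPhysics.FreeFermions Literature.LinearAlgebra.Matrix

namespace Literature.Probability.LatticeModels

variable {N : ℕ}

/-! ### The finite-`N` contraction kernel and its closed form -/

/-- The **finite-`N` contraction of the critical diagonal cylinder state**
`G_N(i, j) = ⟨B_iA_j⟩ = -N⁻¹ ∑_m e^{-iq_mi} e^{iq_mj} e^{-iq_m/2}` (sites as natural numbers; the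
`2 (tfiPol e_{B_i})_{A_j}` of `TransverseIsingFermions.two_mul_tfiPol_single_inr_inl`). [cite: PfeutyAnnPhys1970, §3 (the contraction G_r at λ = 1)] -/
def diagCylKernel (N : ℕ) (i j : ℕ) : ℂ :=
  -((N : ℂ)⁻¹ * ∑ m : Fin N, starRingEnd ℂ (ph (apMom N m) i) * ph (apMom N m) j * (halfPh (apMom N m))⁻¹)

/-- Each term of the kernel is a pure phase: `e^{-iq i} e^{iq j} e^{-iq/2} = e^{iq(j - i - ½)}`. [folklore] -/
theorem diagCylKernel_term (q : ℝ) (i j : ℕ) :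
    starRingEnd ℂ (ph q i) * ph q j * (halfPh q)⁻¹ = Complex.exp (q * (((j : ℤ) - i : ℂ) - 1 / 2) * I) := by
  rw [mul_comm (starRingEnd ℂ (ph q i)), ph_mul_conj_ph, halfPh, ← Complex.exp_neg, ← Complex.exp_add]
  congr 1
  ring

/-- The geometric sum over the antiperiodic momenta of a HALF-INTEGER wave:
`∑_{m<N} e^{i(2m+1)θ} = i / sin θ` for `θ = π(2d-1)/(2N)`, `d ∈ ℤ` (here `e^{2iNθ} = -1` and
`sin θ ≠ 0`). [folklore] -/
theorem sum_exp_apMom_half (N : ℕ) [NeZero N] (d : ℤ) :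
    ∑ m : Fin N, Complex.exp (apMom N m * ((d : ℂ) - 1 / 2) * I) =
      I / ((Real.sin (Real.pi * (2 * d - 1) / (2 * N)) : ℝ) : ℂ) := by
  have hN : (N : ℂ) ≠ 0 := Nat.cast_ne_zero.2 (NeZero.ne N)
  have hNr : (0 : ℝ) < N := Nat.cast_pos.2 (Nat.pos_of_ne_zero (NeZero.ne N))
  set θ : ℝ := Real.pi * (2 * d - 1) / (2 * N) with hθ
  set ζ : ℂ := Complex.exp (2 * θ * I) with hζ
  -- each term is `e^{iθ} ζ^m`
  have hterm : ∀ m : Fin N, Complex.exp (apMom N m * ((d : ℂ) - 1 / 2) * I) =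
      Complex.exp (θ * I) * ζ ^ (m : ℕ) := by
    intro m
    rw [hζ, ← Complex.exp_nat_mul, ← Complex.exp_add]
    congr 1
    unfold apMom
    rw [hθ]
    push_cast
    field_simp
    ring
  simp_rw [hterm]
  rw [← mul_sum, Fin.sum_univ_eq_sum_range (fun i => ζ ^ i) N]
  -- `ζ^N = -1`
  have hζN : ζ ^ N = -1 := by
    rw [hζ, ← Complex.exp_nat_mul]
    have : (N : ℂ) * (2 * (θ : ℂ) * I) = (d : ℂ) * (2 * Real.pi * I) + (-Real.pi) * I := by
      rw [hθ]; push_cast; field_simp; ring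
    rw [this, Complex.exp_add, Complex.exp_int_mul_two_pi_mul_I, one_mul, Complex.exp_mul_I]
    simp [Complex.cos_neg, Complex.sin_neg]
  -- `ζ ≠ 1`: `2θ = π(2d-1)/N` is not a multiple of `2π` (odd vs even)
  have hζ1 : ζ ≠ 1 := by
    intro h1
    rw [hζ, Complex.exp_eq_one_iff] at h1
    obtain ⟨n, hn⟩ := h1
    have hπ : (Real.pi : ℂ) * I ≠ 0 := by simp [Real.pi_ne_zero, Complex.I_ne_zero]
    have h2 : ((2 * d - 1 : ℝ) : ℂ) / N * (Real.pi * I) = (2 * n : ℂ) * (Real.pi * I) := by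
      rw [← mul_left_inj' hπ] at hn ⊢
      · have : 2 * (θ : ℂ) * I = ((2 * d - 1 : ℝ) : ℂ) / N * (Real.pi * I) := by rw [hθ]; push_cast; field_simp
        rw [← this, hn]; ring
    have h3 : ((2 * d - 1 : ℝ) : ℂ) / N = 2 * n := mul_right_cancel₀ hπ h2
    rw [div_eq_iff hN] at h3
    have h4 : (2 * d - 1 : ℤ) = 2 * n * N := by
      have : ((2 * d - 1 : ℤ) : ℂ) = ((2 * n * N : ℤ) : ℂ) := by push_cast; push_cast at h3; linear_combination h3
      exact_mod_cast this
    have h4' : (2 * d - 1 : ℤ) = 2 * (n * N) := by rw [h4]; ring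
    generalize n * (N : ℤ) = t at h4'
    omega
  rw [geom_sum_eq hζ1, hζN]
  -- `e^{iθ} (-2)/(ζ - 1) = i / sin θ`, using `ζ = e^{iθ} e^{iθ}` and `e^{iθ} - e^{-iθ} = 2i sin θ`
  have hsin : ((Real.sin θ : ℝ) : ℂ) ≠ 0 := by
    rw [Complex.ofReal_ne_zero]
    intro hs
    rw [Real.sin_eq_zero_iff] at hs
    obtain ⟨k, hk⟩ := hs
    have : (k : ℝ) * (2 * N) = 2 * d - 1 := by
      rw [hθ] at hk
      field_simp at hk
      nlinarith [Real.pi_pos, hk]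
    have h5 : (k * (2 * N) : ℤ) = 2 * d - 1 := by exact_mod_cast this
    have h5' : 2 * (k * N) = 2 * d - 1 := by rw [← h5]; ring
    generalize k * (N : ℤ) = t at h5'
    omega
  have hE : Complex.exp (θ * I) ≠ 0 := Complex.exp_ne_zero _
  have hE2 : ζ = Complex.exp (θ * I) * Complex.exp (θ * I) := by rw [hζ, ← Complex.exp_add]; ring_nf
  have hEinv : Complex.exp (-(θ * I)) * Complex.exp (θ * I) = 1 := by rw [← Complex.exp_add]; simp
  have hs2 : Complex.exp (θ * I) - Complex.exp (-(θ * I)) = 2 * I * ((Real.sin θ : ℝ) : ℂ) := by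
    rw [Complex.ofReal_sin, Complex.sin]
    have : Complex.exp (-(θ * I)) = Complex.exp (-(θ : ℂ) * I) := by ring_nf
    rw [this]
    ring_nf
    rw [Complex.I_sq]
    ring
  have hden : Complex.exp (θ * I) * Complex.exp (θ * I) - 1 ≠ 0 := fun h0 =>
    hζ1 (by rw [hE2]; exact sub_eq_zero.1 h0)
  rw [hE2, show Complex.exp (θ * I) * ((-1 - 1) / (Complex.exp (θ * I) * Complex.exp (θ * I) - 1)) =
      (Complex.exp (θ * I) * (-1 - 1)) / (Complex.exp (θ * I) * Complex.exp (θ * I) - 1) by ring,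
    div_eq_div_iff hden hsin]
  linear_combination (-I * Complex.exp (θ * I)) * hs2 + (-I) * hEinv +
    (-2 * Complex.exp (θ * I) * ((Real.sin θ : ℝ) : ℂ)) * Complex.I_mul_I

/-- **Closed form of the kernel**: `G_N(i, j) = -i / (N sin(π(2(j-i)-1)/(2N)))` (`N ≥ 1`). [cite: PfeutyAnnPhys1970, §3 (the contraction G_r at λ = 1)] -/
theorem diagCylKernel_eq (N : ℕ) [NeZero N] (i j : ℕ) :
    diagCylKernel N i j = -I / ((N : ℂ) * ((Real.sin (Real.pi * (2 * ((j : ℝ) - i) - 1) / (2 * N)) : ℝ) : ℂ)) := by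
  have h1 : ∑ m : Fin N, starRingEnd ℂ (ph (apMom N m) i) * ph (apMom N m) j * (halfPh (apMom N m))⁻¹ =
      ∑ m : Fin N, Complex.exp (apMom N m * ((((j : ℤ) - i : ℤ) : ℂ) - 1 / 2) * I) := by
    refine sum_congr rfl fun m _ => ?_
    rw [diagCylKernel_term]
    push_cast
    ring_nf
  have h2 : (Real.pi * (2 * (((j : ℤ) - i : ℤ) : ℝ) - 1) / (2 * N)) = Real.pi * (2 * ((j : ℝ) - i) - 1) / (2 * N) := by
    push_cast; ring
  rw [diagCylKernel, h1, sum_exp_apMom_half, h2]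
  have hN : (N : ℂ) ≠ 0 := Nat.cast_ne_zero.2 (NeZero.ne N)
  field_simp

/-! ### The ground-state pair correlation as a determinant -/

section Det

variable [NeZero N]

omit [NeZero N] in
/-- The contraction matrix of the bond string `B_0A_1B_1A_2⋯` for the critical polarization is the
kernel `G_N(i, j+1)`. [folklore] -/
theorem contractionMatrix_diag_eq {n : ℕ} (hnN : n < N) :
    contractionMatrix (tfiPol N) (fun i : Fin n => Sum.inr ⟨i, i.isLt.trans hnN⟩)
        (fun i : Fin n => Sum.inl ⟨i + 1, lt_of_le_of_lt (Nat.succ_le_of_lt i.isLt) hnN⟩) =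
      Matrix.of fun i j : Fin n => diagCylKernel N i (j + 1) := by
  ext i j
  rw [contractionMatrix_apply, two_mul_tfiPol_single_inr_inl, Matrix.of_apply, diagCylKernel]

/-- **The in-layer pair correlation of the critical diagonal cylinder state is an `n × n`
determinant**: for the Perron vector `ψ > 0` of `T₂` at `β = β_c(2)` and `n < N`,
`∑_r r_0 r_n ψ(r)² / ∑_r ψ(r)² = i^n det (G_N(i, j+1))_{i,j<n}` (SML 1964, §V mechanism: the
observable `σᶻ_0σᶻ_n = i^n B_0A_1⋯B_{n-1}A_n`, the Fock vacuum, Wick's theorem in determinant form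
with `⟨B_iB_j⟩ = δ_{ij}`). [cite: SchultzMattisLieb1964, §V, eqs. (5.3)–(5.7)] -/
theorem diagPerron_pair_eq_det {Ω : Row N → ℝ} (hΩ : ∀ r, 0 < Ω r)
    (hAΩ : diagTwoLayer N criticalBetaTwo *ᵥ Ω =
      topEigenvalue (diagTwoLayer_isHermitian (N := N) criticalBetaTwo) • Ω)
    {n : ℕ} (hnN : n < N) :
    (((∑ r, rowPairObs N n (Nat.pos_of_ne_zero (NeZero.ne N)) r * Ω r ^ 2) / ∑ r, Ω r ^ 2 : ℝ) : ℂ) =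
      I ^ n * (Matrix.of fun i j : Fin n => diagCylKernel N i (j + 1)).det := by
  have hvac := isPolarizedVacuum_diagPerron hΩ hAΩ
  have hΩC0 : (fun r => (Ω r : ℂ)) ≠ 0 := by
    intro h
    have h1 : ((Ω fun _ => 1 : ℝ) : ℂ) = 0 := congr_fun h (fun _ => 1)
    exact (hΩ _).ne' (Complex.ofReal_eq_zero.1 h1)
  have hN : 0 < N := Nat.pos_of_ne_zero (NeZero.ne N)
  have hobs : (fun r => rowPairObs N n hN r * Ω r ^ 2) = fun r => rowPairObs N n (lt_of_le_of_lt (Nat.zero_le n) hnN) r * Ω r ^ 2 := rfl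
  rw [ofReal_sum_mul_sq_div, diagonal_rowPairObs_eq hnN, sigmaZC_zero_mul_sigmaZC_eq_prodPairs hnN, smul_mulVec,
    dotProduct_smul, smul_eq_mul, mul_div_assoc,
    expect_prodPairs_div (isMajoranaFamily_isingMajorana N) hvac hΩC0 _ _ (fun i j => Sum.inr_ne_inl)
      (fun i j h => Fin.ext (Fin.mk.inj_iff.1 (Sum.inr_injective h))) (fun i j hij => ?_),
    contractionMatrix_diag_eq hnN]
  exact tfiPol_single_inr_inr_of_ne fun h => hij (Fin.ext (Fin.mk.inj_iff.1 h))

variable (N) in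
/-- The REAL `n × n` matrix `a_N(i, j) = 1 / (N sin(π(2(j-i)+1)/(2N)))` (so that
`G_N(i, j+1) = -i · a_N(i, j)`). [cite: PfeutyAnnPhys1970, §3 (the contraction G_r at λ = 1)] -/
def diagCylReal (n : ℕ) : Matrix (Fin n) (Fin n) ℝ :=
  Matrix.of fun i j : Fin n => 1 / (N * Real.sin (Real.pi * (2 * ((j : ℕ) - (i : ℕ) : ℝ) + 1) / (2 * N)))

/-- `G_N(i, j+1) = -i a_N(i, j)`. [folklore] -/
theorem diagCylKernel_succ_eq (n : ℕ) (i j : Fin n) :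
    diagCylKernel N i (j + 1) = -I * ((diagCylReal N n i j : ℝ) : ℂ) := by
  rw [diagCylKernel_eq, diagCylReal, Matrix.of_apply]
  have h : (2 * ((((j : ℕ) + 1 : ℕ) : ℝ) - ((i : ℕ) : ℕ)) - 1) = 2 * ((j : ℕ) - (i : ℕ) : ℝ) + 1 := by push_cast; ring
  rw [h, Complex.ofReal_div, Complex.ofReal_one, Complex.ofReal_mul, Complex.ofReal_natCast, mul_one_div]

/-- **Real form**: `i^n det (G_N(i, j+1)) = det (a_N(i, j))` (`i^n (-i)^n = 1`). [folklore] -/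
theorem I_pow_mul_det_diagCylKernel (n : ℕ) :
    I ^ n * (Matrix.of fun i j : Fin n => diagCylKernel N i (j + 1)).det = (((diagCylReal N n).det : ℝ) : ℂ) := by
  have hs : (Matrix.of fun i j : Fin n => diagCylKernel N i (j + 1)) = (-I) • (diagCylReal N n).map (algebraMap ℝ ℂ) := by
    ext i j
    rw [Matrix.of_apply, diagCylKernel_succ_eq, Matrix.smul_apply, Matrix.map_apply, smul_eq_mul]
    rfl
  rw [hs, det_smul, Fintype.card_fin, ← RingHom.mapMatrix_apply, ← RingHom.map_det, ← mul_assoc, ← mul_pow, mul_neg, I_mul_I,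
    neg_neg, one_pow, one_mul]
  rfl

/-- The ground-state diagonal pair correlation in real closed form:
`∑_r r_0 r_n ψ² / ∑ ψ² = det (1/(N sin(π(2(j-i)+1)/(2N))))_{i,j<n}`. [cite: PfeutyAnnPhys1970, §3 (the correlation as a Toeplitz determinant)] -/
theorem diagPerron_pair_eq_real_det {Ω : Row N → ℝ} (hΩ : ∀ r, 0 < Ω r)
    (hAΩ : diagTwoLayer N criticalBetaTwo *ᵥ Ω =
      topEigenvalue (diagTwoLayer_isHermitian (N := N) criticalBetaTwo) • Ω)
    {n : ℕ} (hnN : n < N) :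
    (∑ r, rowPairObs N n (Nat.pos_of_ne_zero (NeZero.ne N)) r * Ω r ^ 2) / ∑ r, Ω r ^ 2 = (diagCylReal N n).det := by
  have h := diagPerron_pair_eq_det hΩ hAΩ hnN
  rw [I_pow_mul_det_diagCylKernel] at h
  exact_mod_cast h

end Det

/-! ### The limit `N → ∞` of the determinant -/

/-- `N sin(c/N) → c` as `N → ∞` (the derivative of `sin` at `0`). [folklore] -/
theorem tendsto_nat_mul_sin_div (c : ℝ) : Tendsto (fun N : ℕ => (N : ℝ) * Real.sin (c / N)) atTop (𝓝 c) := by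
  rcases eq_or_ne c 0 with rfl | hc
  · simp
  -- `t⁻¹ sin t → 1` as `t → 0`, `t ≠ 0`
  have hder : Tendsto (fun t : ℝ => t⁻¹ • (Real.sin (0 + t) - Real.sin 0)) (𝓝[≠] 0) (𝓝 (Real.cos 0)) :=
    (hasDerivAt_iff_tendsto_slope_zero.1 (Real.hasDerivAt_sin 0))
  simp only [zero_add, Real.sin_zero, sub_zero, Real.cos_zero, smul_eq_mul] at hder
  -- `c/N → 0` within `≠ 0`
  have hcN : Tendsto (fun N : ℕ => c / (N : ℝ)) atTop (𝓝[≠] 0) := by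
    refine tendsto_nhdsWithin_iff.2 ⟨tendsto_const_nhds.div_atTop tendsto_natCast_atTop_atTop, ?_⟩
    filter_upwards [eventually_gt_atTop 0] with N hN
    exact div_ne_zero hc (Nat.cast_ne_zero.2 hN.ne')
  have h := (hder.comp hcN).const_mul c
  rw [mul_one] at h
  refine h.congr' ?_
  filter_upwards [eventually_gt_atTop 0] with N hN
  have hNne : (N : ℝ) ≠ 0 := Nat.cast_ne_zero.2 hN.ne'
  simp only [Function.comp]
  field_simp

/-- **Entrywise limit**: `a_N(i, j) → 2/(π(2(j-i)+1))` as `N → ∞`. [folklore] -/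
theorem tendsto_diagCylReal_apply (n : ℕ) (i j : Fin n) :
    Tendsto (fun N : ℕ => diagCylReal N n i j) atTop (𝓝 (2 / (Real.pi * (2 * ((j : ℕ) - (i : ℕ) : ℝ) + 1)))) := by
  set c : ℝ := Real.pi * (2 * ((j : ℕ) - (i : ℕ) : ℝ) + 1) / 2 with hc
  have hodd : (2 * ((j : ℕ) - (i : ℕ) : ℝ) + 1) ≠ 0 := by
    intro h
    have h2 : (2 * ((j : ℕ) : ℤ) - 2 * (i : ℕ) + 1 : ℤ) = 0 := by
      have : ((2 * ((j : ℕ) : ℤ) - 2 * (i : ℕ) + 1 : ℤ) : ℝ) = 0 := by push_cast; linarith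
      exact_mod_cast this
    omega
  have hc0 : c ≠ 0 := by rw [hc]; exact div_ne_zero (mul_ne_zero Real.pi_ne_zero hodd) two_ne_zero
  have h := (tendsto_nat_mul_sin_div c).inv₀ hc0
  have hlim : c⁻¹ = 2 / (Real.pi * (2 * ((j : ℕ) - (i : ℕ) : ℝ) + 1)) := by rw [hc]; field_simp
  rw [hlim] at h
  refine h.congr' ?_
  filter_upwards [eventually_gt_atTop 0] with N hN
  rw [diagCylReal, Matrix.of_apply, one_div]
  congr 2
  rw [hc]
  field_simp

/-- **The determinant formula in the limit `N → ∞`**: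
`det (1/(N sin(π(2(j-i)+1)/(2N))))_{i,j<n} → det (2/(π(2(j-i)+1)))_{i,j<n}` — the Cauchy-type
determinant of the critical diagonal correlations (McCoy–Wu 1973, Ch. XI; evaluated as Wu's product
in `PlanarIsingWuCauchy.det_critDiagMatrix`). [cite: MccoyWu1973, Ch. XI (the diagonal correlation ⟨σ_{0,0}σ_{N,N}⟩ at T = T_c)] -/
theorem tendsto_det_diagCylReal (n : ℕ) :
    Tendsto (fun N : ℕ => (diagCylReal N n).det) atTop
      (𝓝 (Matrix.of fun i j : Fin n => 2 / (Real.pi * (2 * ((j : ℕ) - (i : ℕ) : ℝ) + 1))).det) := by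
  have hmat : Tendsto (fun N : ℕ => diagCylReal N n) atTop
      (𝓝 (Matrix.of fun i j : Fin n => 2 / (Real.pi * (2 * ((j : ℕ) - (i : ℕ) : ℝ) + 1)))) :=
    tendsto_pi_nhds.2 fun i => tendsto_pi_nhds.2 fun j => tendsto_diagCylReal_apply n i j
  exact ((Continuous.matrix_det continuous_id).tendsto _).comp hmat

end Literature.Probability.LatticeModels
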